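import Summits.BirchSwinnertonDyer.BirchSwinnertonDyer.Theorems.ByReductionTypeAtTwoSupersingularFlatZetaF3Assembly
import HarnessLib

/-!
# Route `ByReductionTypeAtTwo` (rung K4), crux `SupersingularRankZeroAtTwo` (item stmt-BirchSwinnertonDyer-19097), line
# `odd_blind_package` v2.19, stub 3/5 `stub_flatPackage`, conjunct (8) — **FILE Z7 of hand hF3-ZETA: THE `2`-POWER-SLACK TWIN OF THE
# ASSEMBLY** — the same chain WITHOUT the coprimality of the cusp multipliers AT `(2)` (tower-1 (B1): «μ̃ mod 2 unknown»): then the zeta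
# generator satisfies `A_δ • s₀ = 2^k • x_δ`, and the package holds with F3b replaced by «`ι G = C(2^k)·C(ϖ)·ι L♭`» — the (β)/`C(2^k ϖ)` CANDIDATE
# SHAPE for the LEAD's v2.20 statement question; it is NOT conjunct (8)'s F3b and is not substituted for it anywhere (cell `bsd-2adic`, seat
# `bsd-2adic-t42` GEN 51; `--supports 19097`, helper)

HONEST FRAMING (D-0054): THEOREMS ONLY — no definition, no named fact, no instance, no `sorry`.  CONSUMER over displayed hypotheses (as Z6,
minus `h2`).  A clearly separate `_pow_two` theorem (director (979) rail (3) / head §3: the 2-power slack is a STATEMENT QUESTION for the LEAD;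
this file only shows what the slack form costs and yields).  Helper toward conjunct (8); closes NO stub; 19097 stays OPEN on its 5 registered
stubs; nothing booked; BSD₂ is proved for no supersingular curve and BSD for no curve by any of this; typed ≠ proved.

## What and why
Kato's Thm. 12.5 (4) «`Z(f,T) ⊂ 𝐇¹(T)`, assume `p ≠ 2`» is, AT `2`, the question whether some cusp multiplier `A_δ = C(u·q.num)·μ̃_δ` is ODD in
`Λ = ℤ₂⟦T⟧`.  If not, coprime division (file Z3 `exists_zetaGenerator_pow_two`) still gives `s₀ ∈ 𝐇¹` with `A_δ • s₀ = 2^k • x_δ`, and the whole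
assembly of file Z6 goes through with `2^k` carried along:
* §1 `isEulerSystemClassTwo_C_smul` / `_C_pow_smul`: genuine `2`-adic Euler classes are stable under `ℤ₂`-scalars (`IsEulerSystem.smul`, the
  integral classes form a submodule, `proj_C_smul`), so `2^k • x_δ` is again genuine — the ZL2 clause for the slack generator.
* §2 (`p`-generic) `pair_eq_of_isCongrModOmega` (two solutions of the same Mazur–Tate congruence system coincide: `IsCongrModOmega.exists_mul_sub_eq`
  + `IsChromaticLimit.unique`), ★ `exists_pow_smul_eq_coleman_of_family` (the family's slack Sprung pair: `σ₀`, `k` with `A_δ • σ₀ = p^k • J(L x_δ)` and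
  `C d • σ₀ = p^k • (L♯, L♭)`).
* §3 ★★ `flatF3_package_pow_two_of_levelCongruences`: Z6's hypotheses minus `h2` ⇒ `∃ Z G k, F3a ∧ ι G = C(2^k)·C(ϖ)·ι L♭ ∧ ZL2`.

References: [Kato2004Asterisque] K. Kato, Astérisque 295 (2004), Thm. 12.5 (4), Thm. 12.6 (p. 222), §13.12–13.14 (pp. 231–234); [Sprung2017] Thm. 1.12,
Cor. 4.4; [Rubin2000] Def. 2.1.1 (Euler systems form an `O`-module); [Wuthrich2014] Lemma 10, Lemma 12.
-/

set_option autoImplicit false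
-- the Theorems namespace of this sub repeats the summit name by design (D-0017 nested layout)
set_option linter.dupNamespace false

noncomputable section

open scoped Classical NumberField

open Polynomial

namespace Summit.BirchSwinnertonDyer.BirchSwinnertonDyer.Theorems

namespace SSFlatPackage

open NumberField IsDedekindDomain WeierstrassCurve Literature.NumberTheory.EllipticCurves
  Literature.NumberTheory.EllipticCurves.ZpExtension Literature.NumberTheory.EllipticCurves.Sprung2017
  Literature.NumberTheory.EllipticCurves.Kobayashi2003 Literature.NumberTheory.EllipticCurves.Sprung2012
  Literature.NumberTheory.EllipticCurves.Rank1Residual Literature.NumberTheory.GaloisRepresentations CongruenceSubgroup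

/-! ## §1 Genuine `2`-adic Euler classes are stable under `ℤ₂`-scalars -/

section Genuine

variable (W : WeierstrassCurve ℚ) [W.IsElliptic] [ContinuousSMul ℤ_[2] (W.tateModule 2)]
  [Module.Free ℤ_[2] (W.tateModule 2)] [Module.Finite ℤ_[2] (W.tateModule 2)]
  {κ : ZpExtension ℚ 2} (hκ : κ.IsCyclotomic) {γ : Field.absoluteGaloisGroup ℚ}

/-- **`C a • s` is a genuine `2`-adic Euler class if `s` is** (`a ∈ ℤ₂`): scale the Euler system (`IsEulerSystem.smul`), integrality is a
submodule condition, `proj_C_smul`. [cite: Rubin2000, Def. 2.1.1 and Remark 2.1.4] [cite: Kato2004Asterisque, §13.1 and Thm. 13.4 (pp. 224–226)] -/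
theorem isEulerSystemClassTwo_C_smul (I : Kato2004.IwasawaH1Data W 2 κ γ) {s : I.H}
    (hs : Literature.NumberTheory.EllipticCurves.Kato2004.IsEulerSystemClassTwo W hκ I s) (a : ℤ_[2]) :
    Literature.NumberTheory.EllipticCurves.Kato2004.IsEulerSystemClassTwo W hκ I ((PowerSeries.C a : IwasawaAlgebra 2) • s) := by
  obtain ⟨S, hS, z, hz, hint, hproj⟩ := hs
  refine ⟨S, hS, a • z, hz.smul a, fun k r ↦ Submodule.smul_mem _ a (hint k r), fun n ↦ ?_⟩
  rw [I.proj_C_smul, hproj n, Pi.smul_apply, Pi.smul_apply]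
  exact ((Kato2004.levelToLayerTwo W hκ S n).map_smul a _).symm

/-- The same for the powers `(C 2)^k • s`. [cite: Rubin2000, Def. 2.1.1] -/
theorem isEulerSystemClassTwo_C_pow_smul (I : Kato2004.IwasawaH1Data W 2 κ γ) {s : I.H}
    (hs : Literature.NumberTheory.EllipticCurves.Kato2004.IsEulerSystemClassTwo W hκ I s) (k : ℕ) :
    Literature.NumberTheory.EllipticCurves.Kato2004.IsEulerSystemClassTwo W hκ I
      ((PowerSeries.C (2 : ℤ_[2]) : IwasawaAlgebra 2) ^ k • s) := by
  rw [← map_pow]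
  exact isEulerSystemClassTwo_C_smul W hκ I hs _

end Genuine

/-! ## §2 The slack Sprung pair of a coprime family (`p`-generic) -/

section SprungPair

universe u

variable {K : Type u} [Field K] {p : ℕ} [hp : Fact p.Prime] {κ : ZpExtension K p}
variable {E : Type u} [Field E] [Algebra K E] {ι' : AlgebraicClosure K →ₐ[K] AlgebraicClosure E}
variable {W : WeierstrassCurve K}

/-- **Two solutions of one Mazur–Tate congruence system coincide.**  If `(A, B)` and `(A', B')` both satisfy
`θ_n ≡ −(u_n · + v_n ·) (mod ω_n)` in `Λ ⊗ ℚ_p` for every `n` (any sequence `θ_n ∈ ℚ[T]`), then `(A, B) = (A', B')`: the differences give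
`ω_n ∣ u_n(A − A') + v_n(B − B')` (`IsCongrModOmega.exists_mul_sub_eq`), a chromatic limit of the zero sequence (`IsChromaticLimit.unique`).
[cite: Sprung2017, Thm. 1.12 (uniqueness), Cor. 4.4] -/
theorem pair_eq_of_isCongrModOmega {ap : ℤ} (hap : (p : ℤ) ∣ ap) (θ : ℕ → ℚ[X]) {A B A' B' : IwasawaAlgebra p}
    (h : ∀ n, IsCongrModOmega p n (θ n) (-1) (toIwasawa p (sharpPoly ap p n) * A + toIwasawa p (flatPoly ap p n) * B))
    (h' : ∀ n, IsCongrModOmega p n (θ n) (-1) (toIwasawa p (sharpPoly ap p n) * A' + toIwasawa p (flatPoly ap p n) * B')) :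
    A = A' ∧ B = B' := by
  have hlim : IsChromaticLimit p ap (fun _ ↦ (0 : ℤ_[p][X])) (A - A') (B - B') := by
    intro n
    obtain ⟨r, hr⟩ := (h n).exists_mul_sub_eq (h' n)
    rw [SSFlatPackage.coe_map_neg_one] at hr
    refine ⟨-r, ?_⟩
    rw [Polynomial.coe_zero, zero_add]
    linear_combination -hr
  obtain ⟨hA, hB⟩ := IsChromaticLimit.unique hap hlim (isChromaticLimit_zero ap)
  exact ⟨sub_eq_zero.mp hA, sub_eq_zero.mp hB⟩

/-- `(C(p^k)·θ)^{ℚ_p} = C((p : ℚ_p)^k)·θ^{ℚ_p}`. [folklore] -/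
theorem coe_map_C_pow_mul (k : ℕ) (θ : ℚ[X]) :
    ((Polynomial.map (algebraMap ℚ ℚ_[p]) (Polynomial.C ((p : ℚ) ^ k) * θ) : ℚ_[p][X]) : PowerSeries ℚ_[p]) =
      PowerSeries.C ((p : ℚ_[p]) ^ k) * ((θ.map (algebraMap ℚ ℚ_[p]) : ℚ_[p][X]) : PowerSeries ℚ_[p]) := by
  rw [Polynomial.map_mul, Polynomial.map_C, Polynomial.coe_mul, Polynomial.coe_C, map_pow, map_natCast]

/-- ★ **THE SLACK SPRUNG PAIR OF A COPRIME FAMILY.**  As `exists_smul_eq_coleman_and_isSprungPair_of_family` but with coprimality of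
`(A_δ)` only at the height-one primes `∌ p`: there are `σ₀ ∈ Λ²` and `k` with `A_δ • σ₀ = p^k • J (L x_δ)` for all `δ`, and `(C d·σ₀.1, C d·σ₀.2)`
solves the Mazur–Tate congruences of `p^k·θ_n` — hence equals `(p^k·L♯, p^k·L♭)` for the Sprung pair `(L♯, L♭)`.
[cite: Kato2004Asterisque, Thm. 12.5 (4) and Thm. 12.6 (p. 222), §13.9 (p. 230)] [cite: Sprung2017, Thm. 1.12, Cor. 4.4] -/
theorem exists_pow_smul_eq_coleman_of_family {g : Field.absoluteGaloisGroup E}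
    (hg : κ.IsTopGenerator (resGalOfEmb ι' g)) {ap : ℤ} (hap : (p : ℤ) ∣ ap) {c : ℕ → localPoints W E}
    {H : Type*} [AddCommGroup H] [Module (IwasawaAlgebra p) H]
    (L : letI := moduleOfGenerator κ ι' W hg; H →ₗ[IwasawaAlgebra p] (localTowerPointsOfEmb κ ι' W →+ ℤ_[p]))
    (J : letI := moduleOfGenerator κ ι' W hg
      (localTowerPointsOfEmb κ ι' W →+ ℤ_[p]) →ₗ[IwasawaAlgebra p] IwasawaAlgebra p × IwasawaAlgebra p)
    (hJ : ∀ w, IsColemanPair κ ι' W ap g c w (J w).1 (J w).2)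
    {ι : Type*} (x : ι → H) (A : ι → IwasawaAlgebra p) {d : ℤ_[p]} (hd : d ≠ 0)
    (hcop : ∀ 𝔭 : PrimeSpectrum (IwasawaAlgebra p), 𝔭.asIdeal.height = 1 →
      PowerSeries.C (p : ℤ_[p]) ∉ 𝔭.asIdeal → ∃ i, A i ∉ 𝔭.asIdeal)
    {N : ℕ} (f : CuspForm (Gamma0 N) 2) {Lsharp Lflat : IwasawaAlgebra p} (hL : IsSprungPair f p ap Lsharp Lflat)
    (hE3 : ∀ (i : ι) (n : ℕ), ∃ (m : ℕ) (q : IwasawaAlgebra p), PowerSeries.C ((p : ℚ_[p]) ^ m) *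
        (iwasawaToPowerSeries p (A i) * (((mazurTateElement f p n).map (algebraMap ℚ ℚ_[p]) : ℚ_[p][X]) : PowerSeries ℚ_[p]) -
          iwasawaToPowerSeries p (PowerSeries.C d * pairingSum W (localTowerPointsOfEmb κ ι' W) g n (c n) (L (x i)))) =
      iwasawaToPowerSeries p ((((cyclotomicOmega p n).map (Int.castRingHom ℤ_[p]) : ℤ_[p][X]) : PowerSeries ℤ_[p]) * q)) :
    ∃ (σ₀ : IwasawaAlgebra p × IwasawaAlgebra p) (k : ℕ),
      (∀ i, A i • σ₀ = (PowerSeries.C (p : ℤ_[p]) : IwasawaAlgebra p) ^ k • J (L (x i))) ∧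
      PowerSeries.C d * σ₀.1 = PowerSeries.C (p : ℤ_[p]) ^ k * Lsharp ∧
      PowerSeries.C d * σ₀.2 = PowerSeries.C (p : ℤ_[p]) ^ k * Lflat := by
  letI := moduleOfGenerator κ ι' W hg
  obtain ⟨i₀, hA0⟩ := exists_ne_zero_of_coprime A hcop
  -- proportionality of the Coleman values (Z2)
  have hprop : ∀ i j, A j • J (L (x i)) = A i • J (L (x j)) := by
    intro i j
    obtain ⟨hS, hF⟩ := smul_coleman_eq_of_levelCongruences hap (hJ (L (x i))) (hJ (L (x j))) (A i) (A j) fun n ↦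
      exists_omega_dvd_C_pow_mul_sub_of_thetaCongruences _ hd (hE3 i n) (hE3 j n)
    exact Prod.ext (by simpa [smul_eq_mul] using hS) (by simpa [smul_eq_mul] using hF)
  -- the slack generator in the free module `Λ²` (Z3)
  obtain ⟨σ₀, k, hσ₀⟩ := exists_generator_pow_of_coprime_family (fun i ↦ J (L (x i))) A i₀ hA0 (PowerSeries.C (p : ℤ_[p]))
    hprop (forall_prime_exists_not_dvd_of_forall_heightOne_not_mem A _ hcop)
  refine ⟨σ₀, k, hσ₀, ?_⟩
  -- `(C d·σ₀)` solves the congruences of `p^k·θ_n`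
  have hsol : ∀ n, IsCongrModOmega p n (Polynomial.C ((p : ℚ) ^ k) * mazurTateElement f p n) (-1)
      (toIwasawa p (sharpPoly ap p n) * (PowerSeries.C d * σ₀.1) + toIwasawa p (flatPoly ap p n) * (PowerSeries.C d * σ₀.2)) := by
    intro n
    obtain ⟨a, Θ₀, hΘ⟩ := exists_C_pow_mul_coe_eq_iwasawaToPowerSeries (p := p) ((mazurTateElement f p n).map (algebraMap ℚ ℚ_[p]))
    -- bounded denominators of `p^k·θ_n`
    have hΘk : PowerSeries.C ((p : ℚ_[p]) ^ a) *
        (PowerSeries.C ((p : ℚ_[p]) ^ k) * (((mazurTateElement f p n).map (algebraMap ℚ ℚ_[p]) : ℚ_[p][X]) : PowerSeries ℚ_[p])) =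
        iwasawaToPowerSeries p (PowerSeries.C ((p : ℤ_[p]) ^ k) * Θ₀) := by
      rw [mul_left_comm, hΘ, map_mul, iwasawaToPowerSeries_C_natCast_pow]
    set P₀ : IwasawaAlgebra p := -(toIwasawa p (sharpPoly ap p n) * σ₀.1 + toIwasawa p (flatPoly ap p n) * σ₀.2) with hP₀
    -- `ω_n ∣ p^k·P_n(L x_i) − A_i·P₀`
    have hP : ∀ i, toIwasawa p (cyclotomicOmega p n) ∣
        PowerSeries.C ((p : ℤ_[p]) ^ k) * pairingSum W (localTowerPointsOfEmb κ ι' W) g n (c n) (L (x i)) - A i * P₀ := by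
      intro i
      have h := dvd_mul_of_dvd_right (hJ (L (x i)) n) (PowerSeries.C ((p : ℤ_[p]) ^ k))
      have hs := congrArg Prod.fst (hσ₀ i)
      have hf := congrArg Prod.snd (hσ₀ i)
      rw [Prod.smul_fst, Prod.smul_fst, smul_eq_mul, smul_eq_mul] at hs
      rw [Prod.smul_snd, Prod.smul_snd, smul_eq_mul, smul_eq_mul] at hf
      have e : PowerSeries.C ((p : ℤ_[p]) ^ k) * pairingSum W (localTowerPointsOfEmb κ ι' W) g n (c n) (L (x i)) - A i * P₀ =
          PowerSeries.C ((p : ℤ_[p]) ^ k) * (pairingSum W (localTowerPointsOfEmb κ ι' W) g n (c n) (L (x i)) +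
            (toIwasawa p (sharpPoly ap p n) * (J (L (x i))).1 + toIwasawa p (flatPoly ap p n) * (J (L (x i))).2)) +
          (toIwasawa p (sharpPoly ap p n) * (A i * σ₀.1 - PowerSeries.C (p : ℤ_[p]) ^ k * (J (L (x i))).1) +
            toIwasawa p (flatPoly ap p n) * (A i * σ₀.2 - PowerSeries.C (p : ℤ_[p]) ^ k * (J (L (x i))).2)) := by
        rw [hP₀, map_pow]; ring
      rw [e, hs, hf, sub_self, sub_self, mul_zero, mul_zero, add_zero, add_zero]
      exact h
    -- the E3 congruences scaled by `p^k`
    have hE3k : ∀ i, ∃ (m : ℕ) (q : IwasawaAlgebra p), PowerSeries.C ((p : ℚ_[p]) ^ m) *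
        (iwasawaToPowerSeries p (A i) *
            (PowerSeries.C ((p : ℚ_[p]) ^ k) * (((mazurTateElement f p n).map (algebraMap ℚ ℚ_[p]) : ℚ_[p][X]) : PowerSeries ℚ_[p])) -
          iwasawaToPowerSeries p (PowerSeries.C d *
            (PowerSeries.C ((p : ℤ_[p]) ^ k) * pairingSum W (localTowerPointsOfEmb κ ι' W) g n (c n) (L (x i))))) =
        iwasawaToPowerSeries p ((((cyclotomicOmega p n).map (Int.castRingHom ℤ_[p]) : ℤ_[p][X]) : PowerSeries ℤ_[p]) * q) := by
      intro i
      obtain ⟨m, q, e⟩ := hE3 i n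
      refine ⟨m, PowerSeries.C ((p : ℤ_[p]) ^ k) * q, ?_⟩
      simp only [map_mul, iwasawaToPowerSeries_C_natCast_pow] at e ⊢
      linear_combination (PowerSeries.C ((p : ℚ_[p]) ^ k)) * e
    obtain ⟨m, q, e⟩ := thetaCongruence_of_family A hcop n _ hΘk (PowerSeries.C d) hP hE3k
    refine ⟨m, q, ?_⟩
    rw [coe_map_C_pow_mul, SSFlatPackage.coe_map_neg_one]
    have eP : (-1 : IwasawaAlgebra p) * (toIwasawa p (sharpPoly ap p n) * (PowerSeries.C d * σ₀.1) +
        toIwasawa p (flatPoly ap p n) * (PowerSeries.C d * σ₀.2)) = PowerSeries.C d * P₀ := by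
      rw [hP₀]; ring
    rw [eP]
    exact e
  -- so does `(p^k·L♯, p^k·L♭)`; uniqueness
  have hsol' : ∀ n, IsCongrModOmega p n (Polynomial.C ((p : ℚ) ^ k) * mazurTateElement f p n) (-1)
      (toIwasawa p (sharpPoly ap p n) * (PowerSeries.C (p : ℤ_[p]) ^ k * Lsharp) +
        toIwasawa p (flatPoly ap p n) * (PowerSeries.C (p : ℤ_[p]) ^ k * Lflat)) := by
    intro n
    have h := isCongrModOmega_intCast_mul (hL n) ((p : ℤ) ^ k)
    have e1 : (Polynomial.C ((((p : ℤ) ^ k : ℤ)) : ℚ) : ℚ[X]) = Polynomial.C ((p : ℚ) ^ k) := by push_cast; rfl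
    have e2 : (PowerSeries.C ((((p : ℤ) ^ k : ℤ)) : ℤ_[p]) : IwasawaAlgebra p) *
        (toIwasawa p (sharpPoly ap p n) * Lsharp + toIwasawa p (flatPoly ap p n) * Lflat) =
        toIwasawa p (sharpPoly ap p n) * (PowerSeries.C (p : ℤ_[p]) ^ k * Lsharp) +
          toIwasawa p (flatPoly ap p n) * (PowerSeries.C (p : ℤ_[p]) ^ k * Lflat) := by
      rw [Int.cast_pow, Int.cast_natCast, map_pow]; ring
    rw [e1, e2] at h
    exact h
  exact pair_eq_of_isCongrModOmega hap _ hsol hsol'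

end SprungPair

/-! ## §3 The slack assembly on the habitat (`p = 2`, no coprimality at `(2)`) -/

section Habitat

variable (W : WeierstrassCurve ℚ) [W.IsElliptic] [W.IsGloballyMinimal] [ContinuousSMul ℤ_[2] (W.tateModule 2)]
  [Module.Free ℤ_[2] (W.tateModule 2)] [Module.Finite ℤ_[2] (W.tateModule 2)]
  {κ : ZpExtension ℚ 2} {γ : Field.absoluteGaloisGroup ℚ} (v : HeightOneSpectrum (𝓞 ℚ))
  {g : Field.absoluteGaloisGroup (v.adicCompletion ℚ)} {c : ℕ → localPoints W (v.adicCompletion ℚ)}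

/-- ★★ **THE `2`-POWER-SLACK PACKAGE FROM THE LEVELWISE CONGRUENCES** (Z6 without `h2`).  Same binders and displayed inputs as
`flatF3_package_of_levelCongruences` EXCEPT the coprimality at the height-one prime `(2)`; conclusion: `∃ Z G k`, F3a VERBATIM ∧
«`iwasawaToPowerSeries 2 G = C((2:ℚ₂)^k) * C(ϖ) * iwasawaToPowerSeries 2 Lf`» ∧ ZL2 VERBATIM (the genuine multiples being `2^{k'} • x_δ`).
This is the shape of the (β)/`C(2^k ϖ)` OPTION for the LEAD's v2.20 statement question — NOT conjunct (8)'s F3b.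
[cite: Kato2004Asterisque, Thm. 12.5 (4), Thm. 12.6 (p. 222), §13.12–13.14 (pp. 231–234)] [cite: Sprung2017, Thm. 1.12, Cor. 4.4] [cite: Wuthrich2014, Lemma 12] -/
theorem flatF3_package_pow_two_of_levelCongruences (hss : GoodSS W 2) (hκ : κ.IsCyclotomic) (hγ : κ.IsTopGenerator γ)
    (hg : κ.IsTopGenerator (resGalOfEmb (closureEmb (K := ℚ) (v.adicCompletion ℚ)) g)) {ap : ℤ} (hap : (2 : ℤ) ∣ ap)
    (I : Kato2004.IwasawaH1Data W 2 κ γ) (hrank : Module.rank (IwasawaAlgebra 2) I.H ≤ 1)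
    (L : letI := moduleOfGenerator κ (closureEmb (K := ℚ) (v.adicCompletion ℚ)) W hg
      I.H →ₗ[IwasawaAlgebra 2] (localTowerPointsOfEmb κ (closureEmb (K := ℚ) (v.adicCompletion ℚ)) W →+ ℤ_[2]))
    (J : letI := moduleOfGenerator κ (closureEmb (K := ℚ) (v.adicCompletion ℚ)) W hg
      (localTowerPointsOfEmb κ (closureEmb (K := ℚ) (v.adicCompletion ℚ)) W →+ ℤ_[2]) →ₗ[IwasawaAlgebra 2]
        IwasawaAlgebra 2 × IwasawaAlgebra 2)
    (hJ : ∀ w, IsColemanPair κ (closureEmb (K := ℚ) (v.adicCompletion ℚ)) W ap g c w (J w).1 (J w).2)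
    (P : Submodule (IwasawaAlgebra 2) (IwasawaAlgebra 2)) (loc : I.H →ₗ[IwasawaAlgebra 2] P)
    (hloc : ∀ x : I.H, (loc x : IwasawaAlgebra 2) = (J (L x)).2)
    {N : ℕ} (f : CuspForm (Gamma0 N) 2) (ϖ : ℚ) (Ls Lf : IwasawaAlgebra 2) (hL : IsSprungPair f 2 ap Ls Lf) (hLf : Lf ≠ 0)
    {ι : Type*} (x : ι → I.H) (A : ι → IwasawaAlgebra 2) {d : ℤ_[2]} (hd : d ≠ 0)
    (hE3 : ∀ (i : ι) (n : ℕ), ∃ (m : ℕ) (q : IwasawaAlgebra 2), PowerSeries.C ((2 : ℚ_[2]) ^ m) *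
        (iwasawaToPowerSeries 2 (A i) * (((mazurTateElement f 2 n).map (algebraMap ℚ ℚ_[2]) : ℚ_[2][X]) : PowerSeries ℚ_[2]) -
          iwasawaToPowerSeries 2 (PowerSeries.C d *
            pairingSum W (localTowerPointsOfEmb κ (closureEmb (K := ℚ) (v.adicCompletion ℚ)) W) g n (c n) (L (x i)))) =
      iwasawaToPowerSeries 2 ((((cyclotomicOmega 2 n).map (Int.castRingHom ℤ_[2]) : ℤ_[2][X]) : PowerSeries ℤ_[2]) * q))
    (hcop : ∀ 𝔭 : PrimeSpectrum (IwasawaAlgebra 2), 𝔭.asIdeal.height = 1 →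
      PowerSeries.C (2 : ℤ_[2]) ∉ 𝔭.asIdeal → ∃ i, A i ∉ 𝔭.asIdeal ∧
        Literature.NumberTheory.EllipticCurves.Kato2004.IsEulerSystemClassTwo W hκ I (x i) ∧ x i ≠ 0)
    (t : ℤ_[2]) (ht : (t : ℚ_[2]) = (ϖ : ℚ_[2]) * (d : ℚ_[2])) :
    ∃ (Z : Submodule (IwasawaAlgebra 2) I.H) (G : IwasawaAlgebra 2) (k : ℕ),
      G ∈ Submodule.map (P.subtype ∘ₗ loc) Z ∧
      iwasawaToPowerSeries 2 G = PowerSeries.C ((2 : ℚ_[2]) ^ k) * PowerSeries.C (ϖ : ℚ_[2]) * iwasawaToPowerSeries 2 Lf ∧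
      (∃ s₀ : I.H, Z = Submodule.span (IwasawaAlgebra 2) {s₀} ∧
        ∀ 𝔭 : PrimeSpectrum (IwasawaAlgebra 2), 𝔭.asIdeal.height = 1 →
          PowerSeries.C (2 : ℤ_[2]) ∉ 𝔭.asIdeal →
          ∃ (M : IwasawaAlgebra 2) (s : I.H), M ∉ 𝔭.asIdeal ∧
            Literature.NumberTheory.EllipticCurves.Kato2004.IsEulerSystemClassTwo W hκ I s ∧ s ≠ 0 ∧
            M • s₀ = s) := by
  letI := moduleOfGenerator κ (closureEmb (K := ℚ) (v.adicCompletion ℚ)) W hg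
  haveI := moduleFree_iwasawaH1_two W hss hκ hγ I
  -- dialects
  have hcop' : ∀ 𝔭 : PrimeSpectrum (IwasawaAlgebra 2), 𝔭.asIdeal.height = 1 →
      PowerSeries.C ((2 : ℕ) : ℤ_[2]) ∉ 𝔭.asIdeal → ∃ i, A i ∉ 𝔭.asIdeal := fun 𝔭 h𝔭 hm ↦ by
    obtain ⟨i, hi, -, -⟩ := hcop 𝔭 h𝔭 (by simpa using hm)
    exact ⟨i, hi⟩
  have hcop2 : ∀ 𝔭 : PrimeSpectrum (IwasawaAlgebra 2), 𝔭.asIdeal.height = 1 →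
      PowerSeries.C (2 : ℤ_[2]) ∉ 𝔭.asIdeal → ∃ i, A i ∉ 𝔭.asIdeal := fun 𝔭 h𝔭 hm ↦ by
    obtain ⟨i, hi, -, -⟩ := hcop 𝔭 h𝔭 hm
    exact ⟨i, hi⟩
  have hE3' : ∀ (i : ι) (n : ℕ), ∃ (m : ℕ) (q : IwasawaAlgebra 2), PowerSeries.C (((2 : ℕ) : ℚ_[2]) ^ m) *
        (iwasawaToPowerSeries 2 (A i) * (((mazurTateElement f 2 n).map (algebraMap ℚ ℚ_[2]) : ℚ_[2][X]) : PowerSeries ℚ_[2]) -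
          iwasawaToPowerSeries 2 (PowerSeries.C d *
            pairingSum W (localTowerPointsOfEmb κ (closureEmb (K := ℚ) (v.adicCompletion ℚ)) W) g n (c n) (L (x i)))) =
      iwasawaToPowerSeries 2 ((((cyclotomicOmega 2 n).map (Int.castRingHom ℤ_[2]) : ℤ_[2][X]) : PowerSeries ℤ_[2]) * q) :=
    fun i n ↦ by simpa only [Nat.cast_ofNat] using hE3 i n
  -- the slack Sprung pair of the family in `Λ²`; a non-zero ♭ Coleman value
  obtain ⟨i₀, hA0⟩ := exists_ne_zero_of_coprime A hcop'
  obtain ⟨σ₀, k₀, hσ₀, -, hflat⟩ := exists_pow_smul_eq_coleman_of_family hg hap L J hJ x A hd hcop' f hL hE3'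
  have h2k : ∀ k : ℕ, (PowerSeries.C ((2 : ℕ) : ℤ_[2]) : IwasawaAlgebra 2) ^ k ≠ 0 := fun k ↦
    pow_ne_zero k (Literature.NumberTheory.EllipticCurves.IwasawaAlgebra.prime_C 2).ne_zero
  have hσ2 : σ₀.2 ≠ 0 := by
    intro h0
    refine mul_ne_zero (h2k k₀) hLf ?_
    rw [← hflat, h0, mul_zero]
  have hnz : (J (L (x i₀))).2 ≠ 0 := by
    intro h0
    have h := congrArg Prod.snd (hσ₀ i₀)
    rw [Prod.smul_snd, Prod.smul_snd, smul_eq_mul, smul_eq_mul, h0, mul_zero] at h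
    exact mul_ne_zero hA0 hσ2 h
  -- injectivity of `loc♭` (Z1) and proportionality in `𝐇¹` (Z2)
  obtain ⟨-, hinj⟩ := pairFun_injective_of_flat_ne_zero W κ v hγ hg I hrank L J (x i₀) hnz
  have hprop : ∀ i j, A j • x i = A i • x j := fun i j ↦
    smul_eq_smul_of_thetaCongruences hg hap L J hJ hinj
      (fun n ↦ (((mazurTateElement f 2 n).map (algebraMap ℚ ℚ_[2]) : ℚ_[2][X]) : PowerSeries ℚ_[2])) hd (hE3' i) (hE3' j)
  -- the slack generator `s₀ ∈ 𝐇¹`: `A_δ • s₀ = 2^{k₁} • x_δ` (Z3)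
  obtain ⟨s₀, k₁, hs₀⟩ := exists_zetaGenerator_pow_two W hss hκ hγ I x A i₀ hA0 hprop hcop2
  -- `C d · Col♭(L s₀) = 2^{k₁} · L♭`
  have hCol : (PowerSeries.C d : IwasawaAlgebra 2) * (J (L s₀)).2 =
      (PowerSeries.C ((2 : ℕ) : ℤ_[2]) : IwasawaAlgebra 2) ^ k₁ * Lf := by
    have h1 : A i₀ * (J (L s₀)).2 = (PowerSeries.C (2 : ℤ_[2]) : IwasawaAlgebra 2) ^ k₁ * (J (L (x i₀))).2 := by
      have h := congrArg (fun s ↦ (J (L s)).2) (hs₀ i₀)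
      simpa only [map_smul, Prod.smul_snd, smul_eq_mul] using h
    have h2 : (PowerSeries.C ((2 : ℕ) : ℤ_[2]) : IwasawaAlgebra 2) ^ k₀ * (J (L (x i₀))).2 = A i₀ * σ₀.2 := by
      have h := congrArg Prod.snd (hσ₀ i₀)
      rw [Prod.smul_snd, Prod.smul_snd, smul_eq_mul, smul_eq_mul] at h
      exact h.symm
    have h22 : (PowerSeries.C (2 : ℤ_[2]) : IwasawaAlgebra 2) = PowerSeries.C ((2 : ℕ) : ℤ_[2]) := by norm_num
    rw [h22] at h1
    refine mul_left_cancel₀ (mul_ne_zero (h2k k₀) hA0) ?_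
    linear_combination (PowerSeries.C ((2 : ℕ) : ℤ_[2]) : IwasawaAlgebra 2) ^ k₀ * PowerSeries.C d * h1 +
      PowerSeries.C d * (PowerSeries.C ((2 : ℕ) : ℤ_[2]) : IwasawaAlgebra 2) ^ k₁ * h2 +
      (PowerSeries.C ((2 : ℕ) : ℤ_[2]) : IwasawaAlgebra 2) ^ k₁ * A i₀ * hflat
  -- the package: `Z := Λ∙s₀`, `G := Col♭(L (C t • s₀))`
  refine ⟨Submodule.span (IwasawaAlgebra 2) {s₀}, (loc ((PowerSeries.C t : IwasawaAlgebra 2) • s₀) : IwasawaAlgebra 2), k₁,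
    ⟨(PowerSeries.C t : IwasawaAlgebra 2) • s₀, Submodule.smul_mem _ _ (Submodule.mem_span_singleton_self s₀), rfl⟩, ?_,
    s₀, rfl, fun 𝔭 h𝔭 h2𝔭 ↦ ?_⟩
  · -- `ι(t·Col♭(L s₀)) = C ϖ · ι(C d·Col♭(L s₀)) = C(2^{k₁}) · C ϖ · ι L♭`
    have hι := congrArg (iwasawaToPowerSeries 2) hCol
    rw [map_mul, map_mul, map_pow, PowerSeries.map_C, PowerSeries.map_C, map_natCast, Nat.cast_ofNat] at hι
    have ht' : algebraMap ℤ_[2] ℚ_[2] t = (ϖ : ℚ_[2]) * algebraMap ℤ_[2] ℚ_[2] d := ht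
    rw [hloc, map_smul, map_smul, Prod.smul_snd, smul_eq_mul, map_mul, PowerSeries.map_C, ht', map_mul, mul_assoc, hι,
      map_pow]
    ring
  · obtain ⟨i, hi, hE, hx⟩ := hcop 𝔭 h𝔭 h2𝔭
    refine ⟨A i, (PowerSeries.C (2 : ℤ_[2]) : IwasawaAlgebra 2) ^ k₁ • x i, hi, isEulerSystemClassTwo_C_pow_smul W hκ I hE k₁, ?_, hs₀ i⟩
    intro h0
    have h2k' : (PowerSeries.C (2 : ℤ_[2]) : IwasawaAlgebra 2) ^ k₁ ≠ 0 :=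
      pow_ne_zero k₁ (Literature.NumberTheory.EllipticCurves.IwasawaAlgebra.prime_C 2).ne_zero
    exact hx (smul_cancel_of_ne_zero h2k' (h0.trans (smul_zero _).symm))

end Habitat

end SSFlatPackage

end Summit.BirchSwinnertonDyer.BirchSwinnertonDyer.Theorems

end
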